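import Mathlib
import Summits.NavierStokesRegularity.NavierStokesRegularity.Theorems.FilamentSkeletonRssSkeletonJ1RLineDefs
import Summits.NavierStokesRegularity.NavierStokesRegularity.Theorems.FilamentSkeletonRssSkeletonJ1RLiaRates
import Summits.NavierStokesRegularity.NavierStokesRegularity.Theorems.FilamentSkeletonRssSkeletonJ1RSlicedModel

/-!
# Route `FilamentSkeletonRss` · crux `SkeletonJ1R` (stmt-NavierStokesRegularity-23610) · registered line `streamline_kantorovich_R`
# — STUB F1 `stub_liaFrameExistsL : LiaFrameExistsL` (the LIA reference frame EXISTS at contraction rate `λ = 1`)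

Lead `ns-fsr-lead-23610` (g0), `--supports stmt-NavierStokesRegularity-23610` (registered stub F1 of the skeleton of record).  Assembly of the
chain `…LiaShooting` (p712316) → `…LiaBootstrap` (p713477) → `…LiaGeometry` (p713583) → `…LiaReference` → `…LiaSliced` → `…LiaRates` and
`…MonoInverse` (p714809) → `…SlicedModel`:
* `IsLiaReference.contDiff_three` — the reference is `C³` (bootstrapping the ODE: `x″ = Φ(x, x′)` with `Φ` smooth);
* `tiltBudget_exists` — a positive tilt budget `θ₁ ≤ ½` below every pairwise bound `min (√θd/4) (θd ρ/(16(‖q_j − q_k‖ + ρ)))`;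
* `stub_liaFrameExistsL` — for a general-position straight datum: `Rb₁ := min 1 (min Rb₁^{rates} (4θ₁))`; for `0 < Rb ≤ Rb₁` and
  `Γ ≥ Γ₁(datum, Rb)` (`curvCeil_rates_all`), THE LIA reference exists (`liaReference_exists`), is a sliced reference
  (`IsLiaReference.slicedReference`), and carries the explicit datum-sliced model (`slicedModel_exists`, `λ = 1`, slice radius `ρ√Γ/8`).

HONEST FRAMING.  Closes registered stub F1 of the ∃-side DECIDING crux of a HYPOTHETICAL filament-type rotating-self-similar blow-up skeleton
(MODEL rung, negative side).  Stubs F2 (defect rate), L (reference injectivity), K (Kantorovich closing), D (flat output) and 13-R remain OPEN, as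
do the crux 23610 and the heart 23320; nothing here is a claim about Navier–Stokes regularity or blow-up.
-/

set_option linter.dupNamespace false -- `NavierStokesRegularity.NavierStokesRegularity` path/namespace repetition is the tree convention

noncomputable section

namespace Summit.NavierStokesRegularity.NavierStokesRegularity.Theorems.SkeletonJ1RFrame

open Set Function Filter Real Topology
open Literature.Analysis.FluidPDE
open Summit.NavierStokesRegularity.NavierStokesRegularity.Theorems.FilamentSkeletonRssSkeletonJ1GSplit (NearStraightJ1G StraightDatum)
open scoped InnerProductSpace BigOperators

/-! ## §1 The reference is `C³` -/

/-- **The LIA reference is `C³`** (unit datum directions): its second derivative is a smooth function of `(x, x′)`. [folklore] -/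
theorem IsLiaReference.contDiff_three {N : ℕ} {Γ Rb : ℝ} {p t : Fin N → EuclideanSpace ℝ (Fin 3)} {γ : Fin N → ℝ} {α : ℝ}
    {s₀ : Fin N → ℝ} {x : Fin N → ℝ → EuclideanSpace ℝ (Fin 3)} (hx : IsLiaReference Γ Rb p t γ α s₀ x) (ht : ∀ k, ‖t k‖ = 1)
    (j : Fin N) : ContDiff ℝ 3 (x j) := by
  obtain ⟨hC2, hunit, h0, h0', hode⟩ := hx j
  have hxd : Differentiable ℝ (x j) := hC2.differentiable (by norm_num)
  have hx'C1 : ContDiff ℝ 1 (deriv (x j)) := (contDiff_succ_iff_deriv.1 (show ContDiff ℝ (1 + 1) (x j) from hC2)).2.2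
  have hx'd : Differentiable ℝ (deriv (x j)) := hx'C1.differentiable (by norm_num)
  -- the right-hand side as a smooth function of (position, velocity)
  set Φ : EuclideanSpace ℝ (Fin 3) × EuclideanSpace ℝ (Fin 3) → EuclideanSpace ℝ (Fin 3) := fun q =>
    ((liaCoeff Γ γ j)⁻¹ * refCutoff (Rb * Real.sqrt (Γ * Real.log Γ)) q.1) • crossCLM q.2 (ambientField Γ p t γ α s₀ j q.1) with hΦ
  have hΦC : ContDiff ℝ 1 Φ := by
    refine ((contDiff_const.mul ((contDiff_refCutoff _ (n := 1)).comp contDiff_fst)).smul ?_)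
    exact (crossCLM).isBoundedBilinearMap.contDiff.comp
      (contDiff_snd.prodMk ((contDiff_ambientField Γ p t γ α s₀ ht j (n := 1)).comp contDiff_fst))
  have hdd : deriv (deriv (x j)) = fun τ => Φ (x j τ, deriv (x j) τ) := by
    funext τ
    have h2 : iteratedDeriv 2 (x j) = deriv (deriv (x j)) := by rw [iteratedDeriv_succ, iteratedDeriv_one]
    rw [← h2, hode τ]
    simp only [hΦ, crossCLM_apply]
  have hddC : ContDiff ℝ 1 (deriv (deriv (x j))) := by
    rw [hdd]; exact hΦC.comp (hC2.of_le (by norm_num) |>.prodMk hx'C1)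
  have hx'C2 : ContDiff ℝ 2 (deriv (x j)) := by
    rw [show (2 : WithTop ℕ∞) = 1 + 1 from rfl, contDiff_succ_iff_deriv]
    exact ⟨hx'd, fun h => absurd h (by decide), hddC⟩
  rw [show (3 : WithTop ℕ∞) = 2 + 1 from rfl, contDiff_succ_iff_deriv]
  exact ⟨hxd, fun h => absurd h (by decide), hx'C2⟩

/-! ## §2 A tilt budget below all pairwise bounds -/

/-- A positive tilt budget `θ₁ ≤ ½` with `θ₁ ≤ min (√θd/4) (θd ρ/(16(‖q_j − q_k‖ + ρ)))` for all pairs (`θd, ρ > 0`). [folklore] -/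
theorem tiltBudget_exists {N : ℕ} (θd ρ : ℝ) (q : Fin N → EuclideanSpace ℝ (Fin 3)) (hθd : 0 < θd) (hρ : 0 < ρ) :
    ∃ θ₁ : ℝ, 0 < θ₁ ∧ θ₁ ≤ 1 / 2 ∧ ∀ j k : Fin N, θ₁ ≤ min (Real.sqrt θd / 4) (θd * ρ / (16 * (‖q j - q k‖ + ρ))) := by
  set B := ∑ j, ∑ k, ‖q j - q k‖ with hB
  have hB0 : 0 ≤ B := Finset.sum_nonneg fun j _ => Finset.sum_nonneg fun k _ => norm_nonneg _
  have hBjk : ∀ j k, ‖q j - q k‖ ≤ B := by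
    intro j k
    calc ‖q j - q k‖ ≤ ∑ k', ‖q j - q k'‖ := Finset.single_le_sum (fun k' _ => norm_nonneg (q j - q k')) (Finset.mem_univ k)
      _ ≤ B := Finset.single_le_sum (fun j' _ => Finset.sum_nonneg fun k' _ => norm_nonneg (q j' - q k')) (Finset.mem_univ j)
  refine ⟨min (1 / 2) (min (Real.sqrt θd / 4) (θd * ρ / (16 * (B + ρ)))), ?_, min_le_left _ _, fun j k => ?_⟩
  · have : 0 < Real.sqrt θd := Real.sqrt_pos.2 hθd
    exact lt_min (by norm_num) (lt_min (by positivity) (by positivity))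
  · refine (min_le_right _ _).trans (le_min (min_le_left _ _) ((min_le_right _ _).trans ?_))
    exact div_le_div_of_nonneg_left (by positivity) (by positivity) (by nlinarith [hBjk j k])

/-! ## §3 Stub F1 -/

/-- **STUB F1 · `stub_liaFrameExistsL`** — the LIA reference frame EXISTS at contraction rate `λ = 1`: for every general-position straight datum
there is `Rb₁ > 0` such that for every `0 < Rb ≤ Rb₁` there is `Γ₁` with, for all `Γ ≥ Γ₁`, a reference `x` solving the cut-off local-induction
IVP (`IsLiaReference`) and a model `M` forming a datum-sliced frame (`SlicedFrame Γ ρd 1 Rb p t s₀ x M`).  Registered stub of the skeleton of record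
`streamline_kantorovich_R` (crux stmt-NavierStokesRegularity-23610). [folklore] -/
theorem stub_liaFrameExistsL : LiaFrameExistsL := by
  intro N δd ρd Λd Rwd θd mw p t γ α s₀ hN hδ hρ hRw hθ hmw hSD hGP
  obtain ⟨ht, hsep, -, hparams, -, -⟩ := hSD
  have hγ : ∀ j, γ j ≠ 0 := fun j => by
    have := (hparams.2.2 j).1; intro h0; rw [h0, abs_zero] at this; linarith
  -- general position with θd' = min θd 1 ∈ (0, 1]
  set θd' := min θd 1 with hθd'
  have hθd'0 : 0 < θd' := lt_min hθ one_pos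
  have hθd'1 : θd' ≤ 1 := min_le_right _ _
  have hGP' : ∀ j k, j ≠ k → |inner ℝ (t j) (t k)| ≤ 1 - θd' := fun j k hjk =>
    (hGP j k hjk).trans (by linarith [min_le_left θd 1])
  -- tilt budget and rates
  obtain ⟨θ₁, hθ₁0, hθ₁h, hθ₁A⟩ := tiltBudget_exists θd' ρd (fun j => p j + s₀ j • t j) hθd'0 hρ
  obtain ⟨RbR, hRbR0, hrates⟩ := curvCeil_rates_all hN ρd p t s₀ γ α hρ hγ
  refine ⟨min 1 (min RbR (4 * θ₁)), lt_min one_pos (lt_min hRbR0 (by positivity)), fun Rb hRb hRb₁ => ?_⟩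
  have hRb1 : Rb ≤ 1 := hRb₁.trans (min_le_left _ _)
  have hRbR : Rb ≤ RbR := hRb₁.trans ((min_le_right _ _).trans (min_le_left _ _))
  have hRbθ : Rb / 8 < θ₁ := by
    have : Rb ≤ 4 * θ₁ := hRb₁.trans ((min_le_right _ _).trans (min_le_right _ _)); linarith
  obtain ⟨Γ₁, hΓ₁3, hΓrates⟩ := hrates Rb hRb hRbR
  refine ⟨Γ₁, fun Γ hΓ => ?_⟩
  have hΓ0 : 0 < Γ := by linarith
  obtain ⟨hrate, hrate2, hℓ⟩ := hΓrates Γ hΓ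
  -- the reference
  obtain ⟨x, hx⟩ := liaReference_exists Γ Rb p t γ α s₀ ht
  have hsl : SlicedReference Γ ρd Rb p t s₀ x :=
    hx.slicedReference ht hθd'0 hθd'1 hGP' hρ hsep hΓ0 hℓ hRbθ hθ₁h (fun j k hk => hθ₁A j k) hrate hrate2
  obtain ⟨hbase, htilt, hcurv, hsepx⟩ := hsl
  -- the model
  have hr : 0 < ρd * Real.sqrt Γ / 8 := by have := Real.sqrt_pos.2 hΓ0; positivity
  obtain ⟨M, hMC, hMgrowth, hMslice⟩ := slicedModel_exists (fun j => hx.contDiff_three ht j) (fun j => (hbase j).2.1) ht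
    (fun j τ => (htilt j τ).trans (by linarith)) hr
    (fun j k hjk τ σ => by have := hsepx j k hjk τ σ; linarith) 1
  exact ⟨x, M, hx, ⟨hbase, htilt, hcurv, hsepx⟩, hMC, hMgrowth, fun j τ z hz hzr => hMslice j τ z hz hzr⟩

end Summit.NavierStokesRegularity.NavierStokesRegularity.Theorems.SkeletonJ1RFrame

end
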